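import Summits.QuantumFields.YangMills.Theorems.FlatTubeReductionOrthoDensityFlatMap
import Summits.QuantumFields.YangMills.Theorems.LuscherReductionTwistedTraceScalingBTTubeKinetic
import Mathlib.Analysis.Calculus.InverseFunctionTheorem.FDeriv
import Mathlib.Analysis.SpecialFunctions.Sqrt
import HarnessLib

/-!
# The flat chart map of the orthographic tube, II: quadratic remainder, `C¹` at `0`, STRICT differentiability with derivative `orthoFlatLin L`, approximate linearity near `0`
# («(E′)-lite» infrastructure; route `FlatTubeReduction`, crux K1 `NearFlatRatioLaw` stmt-QuantumFields-24720; seat `ym-line-ftr-p1` g16; R2b1 RECORD rung — no summit statement is proved here)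

WHY (memo `Cruxes/NearFlatRatioLaw/Lines/ratepack-v5-nearpair-g16.md` §5).  Mathlib's volume-distortion lemmas for maps that are `δ`-approximately linear on a set
(`MeasureTheory.addHaar_image_le_mul_of_det_lt`, `MeasureTheory.mul_le_addHaar_image_of_lt_det`) turn the flat chart map `G = orthoFlat L` into a two-sided comparison
`vol(G(S)) ≍ |det DG(0)|·vol(S)` near `0` WITHOUT computing any Jacobian determinant beyond `det DG(0) ≠ 0` (`…FlatMap.orthoFlatLin_det_ne_zero`).  Their hypothesis
`ApproximatesLinearOn G DG(0) (ball 0 ρ) δ` follows from STRICT differentiability at `0` (`HasStrictFDerivAt.approximates_deriv_on_nhds`), which we get from `C¹` (a rational–radical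
formula in linear coordinates, `ContDiffAt.hasStrictFDerivAt`) plus the identification of the derivative by an explicit quadratic remainder bound.
* `orthoFlat_sub_lin_eq`, ★★ `abs_orthoFlat_sub_lin_le` (`|G(y) − DG(0)y| ≤ 10N²‖y‖²` on `‖y‖ ≤ 1/(4N)`), `norm_orthoFlat_sub_lin_le`;
* ★★ `hasFDerivAt_orthoFlat_zero`; `contDiff_balFill_apply`, `contDiff_apply_apply`, ★ `contDiffAt_orthoFlat_zero`;
* ★★★ `hasStrictFDerivAt_orthoFlat_zero`, ★★ `approximatesLinearOn_orthoFlat`.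
HONEST FRAMING: elementary calculus (Mathlib); femto rung R2b1 (RECORD label); not infinite volume, not a gap, not Clay.  No defs, no named facts, no `sorry`.
-/

set_option autoImplicit false

noncomputable section

open MeasureTheory Filter Topology Real
open scoped BigOperators Matrix NNReal
open Literature.MathematicalPhysics.QuantumFieldTheory
open Literature.MathematicalPhysics.QuantumLattice
open Literature.MathematicalPhysics.QuantumFieldTheory.Balaban1983to89.T4CubeChartGnomonic (gnoPoint)

namespace Summit.QuantumFields.YangMills.Theorems.FemtoTransferGap.TwoLattice.ConstTube

open Summit.QuantumFields.YangMills.Theorems.FemtoTransferGap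
open Asymptotics

variable (L : ℕ) [NeZero L]

/-! ## §4 The flat chart map is strictly differentiable at `0` with derivative `orthoFlatLin L` -/

/-- The algebra of the remainder: `G − lin = ((v × b)_a + (1 − p₀)v_a + (v·b)(v_a + b_a))/(p₀ − v·b)`. [folklore] -/
theorem orthoFlat_sub_lin_eq (y : Edge 3 L → Fin 3 → ℝ) (e : Edge 3 L) (a : Fin 3)
    (hden : Real.sqrt (1 - ∑ c, balFill L y e c ^ 2) - balFill L y e ⬝ᵥ y (0, e.2) ≠ 0) :
    orthoFlat L y e a - orthoFlatLin L y e a =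
      ((balFill L y e ⨯₃ y (0, e.2)) a + (1 - Real.sqrt (1 - ∑ c, balFill L y e c ^ 2)) * balFill L y e a +
          (balFill L y e ⬝ᵥ y (0, e.2)) * (balFill L y e a + y (0, e.2) a)) /
        (Real.sqrt (1 - ∑ c, balFill L y e c ^ 2) - balFill L y e ⬝ᵥ y (0, e.2)) := by
  rw [orthoFlatLin_apply, eq_div_iff hden, sub_mul]
  simp only [orthoFlat]
  rw [div_mul_cancel₀ _ hden]
  ring

/-- ★★ **THE QUADRATIC REMAINDER**: for `‖y‖ ≤ 1/(4N)`, `|orthoFlat L y e a − orthoFlatLin L y e a| ≤ 10N²‖y‖²` (`N = #sites`). [folklore] -/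
theorem abs_orthoFlat_sub_lin_le {y : Edge 3 L → Fin 3 → ℝ} (hy : ‖y‖ ≤ 1 / (4 * Fintype.card (Site 3 L))) (e : Edge 3 L) (a : Fin 3) :
    |orthoFlat L y e a - orthoFlatLin L y e a| ≤ 10 * (Fintype.card (Site 3 L) : ℝ) ^ 2 * ‖y‖ ^ 2 := by
  obtain ⟨h1, h2, h3⟩ := orthoFlat_regime L hy e
  set N : ℝ := (Fintype.card (Site 3 L) : ℝ) with hNdef
  have hN1 : (1 : ℝ) ≤ N := by rw [hNdef]; exact_mod_cast Fintype.card_pos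
  set r : ℝ := ‖y‖
  have hr0 : 0 ≤ r := norm_nonneg _
  have hrN : N * r ≤ 1 / 4 := by
    calc N * r ≤ N * (1 / (4 * N)) := mul_le_mul_of_nonneg_left hy (by positivity)
      _ = 1 / 4 := by field_simp
  set v : Fin 3 → ℝ := balFill L y e
  set b : Fin 3 → ℝ := y (0, e.2)
  set p₀ : ℝ := Real.sqrt (1 - ∑ c, v c ^ 2)
  have hden : p₀ - v ⬝ᵥ b ≠ 0 := by intro h; simp only [p₀, v, b] at h; linarith
  have hva : ∀ c, |v c| ≤ N * r := fun c => abs_balFill_le L y e c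
  have hba : ∀ c, |b c| ≤ r := fun c => abs_apply_le_norm L y _ c
  have hvn : ‖v‖ ≤ N * r := (pi_norm_le_iff_of_nonneg (by positivity)).2 fun c => by rw [Real.norm_eq_abs]; exact hva c
  have hbn : ‖b‖ ≤ r := (pi_norm_le_iff_of_nonneg hr0).2 fun c => by rw [Real.norm_eq_abs]; exact hba c
  -- the three pieces of the numerator
  have hcross : |(v ⨯₃ b) a| ≤ 2 * (N * r) * r := by
    have h := norm_cross_le_two v b
    calc |(v ⨯₃ b) a| = ‖(v ⨯₃ b) a‖ := (Real.norm_eq_abs _).symm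
      _ ≤ ‖v ⨯₃ b‖ := norm_le_pi_norm _ a
      _ ≤ 2 * (‖v‖ * ‖b‖) := h
      _ ≤ 2 * (N * r) * r := by nlinarith [norm_nonneg v, norm_nonneg b]
  have hs0 : 0 ≤ ∑ c, v c ^ 2 := Finset.sum_nonneg fun c _ => sq_nonneg _
  have hs3 : ∑ c, v c ^ 2 ≤ 3 * (N * r) ^ 2 := sum_sq_le_three_mul_sq hva
  have hp : |(1 - p₀) * v a| ≤ 3 * (N * r) ^ 2 * (N * r) := by
    rw [abs_mul]
    refine mul_le_mul ?_ (hva a) (abs_nonneg _) (by positivity)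
    rw [abs_of_nonneg (by simp only [p₀]; exact sub_nonneg.2 (Real.sqrt_le_one.mpr (by linarith)))]
    exact (one_sub_sqrt_one_sub_le hs0 (h1.trans (by norm_num))).trans hs3
  have hdot : |v ⬝ᵥ b * (v a + b a)| ≤ 3 * ((N * r) * r) * ((N + 1) * r) := by
    rw [abs_mul]
    refine mul_le_mul ((abs_dotProduct_le_three v b).trans (by nlinarith [norm_nonneg v, norm_nonneg b])) ?_ (abs_nonneg _) (by positivity)
    calc |v a + b a| ≤ |v a| + |b a| := abs_add_le _ _
      _ ≤ N * r + r := add_le_add (hva a) (hba a)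
      _ = (N + 1) * r := by ring
  -- numerator ≤ 5N² r², denominator ≥ 1/2
  have hnum : |(v ⨯₃ b) a + (1 - p₀) * v a + v ⬝ᵥ b * (v a + b a)| ≤ 5 * N ^ 2 * r ^ 2 := by
    have hA := (abs_add_three _ _ _).trans (add_le_add (add_le_add hcross hp) hdot)
    refine hA.trans ?_
    have e1 : 3 * (N * r) ^ 2 * (N * r) = (3 * N ^ 2 * (N * r)) * r ^ 2 := by ring
    have e2 : 3 * ((N * r) * r) * ((N + 1) * r) = (3 * (N + 1) * (N * r)) * r ^ 2 := by ring
    rw [e1, e2]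
    have hr2 : 0 ≤ r ^ 2 := sq_nonneg _
    have ha : 3 * N ^ 2 * (N * r) * r ^ 2 ≤ 3 * N ^ 2 * (1 / 4) * r ^ 2 :=
      mul_le_mul_of_nonneg_right (mul_le_mul_of_nonneg_left hrN (by positivity)) hr2
    have hb' : 3 * (N + 1) * (N * r) * r ^ 2 ≤ 3 * (N + 1) * (1 / 4) * r ^ 2 :=
      mul_le_mul_of_nonneg_right (mul_le_mul_of_nonneg_left hrN (by positivity)) hr2
    have hc : 2 * (N * r) * r = 2 * N * r ^ 2 := by ring
    have hd : 2 * N * r ^ 2 ≤ 2 * N ^ 2 * r ^ 2 := mul_le_mul_of_nonneg_right (by nlinarith) hr2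
    have he : 3 * (N + 1) * (1 / 4) * r ^ 2 ≤ 3 * N ^ 2 / 2 * r ^ 2 := mul_le_mul_of_nonneg_right (by nlinarith) hr2
    rw [hc]
    linarith
  rw [orthoFlat_sub_lin_eq L y e a hden, abs_div, div_le_iff₀ (abs_pos.2 hden)]
  have hden2 : 1 / 2 ≤ |p₀ - v ⬝ᵥ b| := h3.trans (le_abs_self _)
  calc |(v ⨯₃ b) a + (1 - p₀) * v a + v ⬝ᵥ b * (v a + b a)| ≤ 5 * N ^ 2 * r ^ 2 := hnum
    _ = 10 * N ^ 2 * r ^ 2 * (1 / 2) := by ring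
    _ ≤ 10 * N ^ 2 * r ^ 2 * |p₀ - v ⬝ᵥ b| := mul_le_mul_of_nonneg_left hden2 (by positivity)

/-- The remainder in sup norm: `‖orthoFlat L y − orthoFlatLin L y‖ ≤ 10N²‖y‖²` on `‖y‖ ≤ 1/(4N)`. [folklore] -/
theorem norm_orthoFlat_sub_lin_le {y : Edge 3 L → Fin 3 → ℝ} (hy : ‖y‖ ≤ 1 / (4 * Fintype.card (Site 3 L))) :
    ‖orthoFlat L y - orthoFlatLin L y‖ ≤ 10 * (Fintype.card (Site 3 L) : ℝ) ^ 2 * ‖y‖ ^ 2 := by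
  refine (pi_norm_le_iff_of_nonneg (by positivity)).2 fun e => (pi_norm_le_iff_of_nonneg (by positivity)).2 fun a => ?_
  rw [Pi.sub_apply, Pi.sub_apply, Real.norm_eq_abs]
  exact abs_orthoFlat_sub_lin_le L hy e a

/-- ★★ **`orthoFlat L` is differentiable at `0` with derivative `orthoFlatLin L`** (quadratic remainder). [folklore] -/
theorem hasFDerivAt_orthoFlat_zero : HasFDerivAt (orthoFlat L) (orthoFlatLin L) 0 := by
  rw [hasFDerivAt_iff_isLittleO_nhds_zero]
  refine isLittleO_iff.2 fun c hc => ?_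
  have hN : (0 : ℝ) < Fintype.card (Site 3 L) := by exact_mod_cast Fintype.card_pos
  set K : ℝ := 10 * (Fintype.card (Site 3 L) : ℝ) ^ 2
  have hK : 0 < K := by positivity
  have hρ : 0 < min (1 / (4 * (Fintype.card (Site 3 L) : ℝ))) (c / K) := lt_min (by positivity) (div_pos hc hK)
  filter_upwards [Metric.closedBall_mem_nhds (0 : Edge 3 L → Fin 3 → ℝ) hρ] with h hh
  rw [mem_closedBall_zero_iff] at hh
  have h1 : ‖h‖ ≤ 1 / (4 * (Fintype.card (Site 3 L) : ℝ)) := hh.trans (min_le_left _ _)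
  have h2 : ‖h‖ ≤ c / K := hh.trans (min_le_right _ _)
  rw [zero_add, orthoFlat_zero, sub_zero]
  calc ‖orthoFlat L h - orthoFlatLin L h‖ ≤ K * ‖h‖ ^ 2 := norm_orthoFlat_sub_lin_le L h1
    _ = (K * ‖h‖) * ‖h‖ := by ring
    _ ≤ c * ‖h‖ := by
      refine mul_le_mul_of_nonneg_right ?_ (norm_nonneg _)
      calc K * ‖h‖ ≤ K * (c / K) := mul_le_mul_of_nonneg_left h2 hK.le
        _ = c := by field_simp

/-- Each coordinate of the balancing fill is a smooth (linear) function of `y`. [folklore] -/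
theorem contDiff_balFill_apply (e : Edge 3 L) (c : Fin 3) {n : WithTop ℕ∞} : ContDiff ℝ n fun y : Edge 3 L → Fin 3 → ℝ => balFill L y e c := by
  have h : (fun y : Edge 3 L → Fin 3 → ℝ => balFill L y e c) =
      fun y => ((ContinuousLinearMap.proj (R := ℝ) (φ := fun _ : Fin 3 => ℝ) c).comp
        ((ContinuousLinearMap.proj (R := ℝ) (φ := fun _ : Edge 3 L => Fin 3 → ℝ) e).comp
          ((balExt L).comp (ContinuousLinearMap.pi fun e' : {e : Edge 3 L // ¬e.1 = 0} =>
            ContinuousLinearMap.proj (R := ℝ) (φ := fun _ : Edge 3 L => Fin 3 → ℝ) e'.1)))) y := by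
    funext y; rfl
  rw [h]; exact ContinuousLinearMap.contDiff _

/-- Each coordinate `y ↦ y e c` is smooth. [folklore] -/
theorem contDiff_apply_apply (e : Edge 3 L) (c : Fin 3) {n : WithTop ℕ∞} : ContDiff ℝ n fun y : Edge 3 L → Fin 3 → ℝ => y e c := by
  have h : (fun y : Edge 3 L → Fin 3 → ℝ => y e c) =
      fun y => ((ContinuousLinearMap.proj (R := ℝ) (φ := fun _ : Fin 3 => ℝ) c).comp
        (ContinuousLinearMap.proj (R := ℝ) (φ := fun _ : Edge 3 L => Fin 3 → ℝ) e)) y := by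
    funext y; rfl
  rw [h]; exact ContinuousLinearMap.contDiff _

/-- ★ **`orthoFlat L` is `C¹` (indeed smooth) at `0`**: a rational–radical expression in linear coordinates with non-vanishing radicand and denominator at `0`. [folklore] -/
theorem contDiffAt_orthoFlat_zero {n : WithTop ℕ∞} : ContDiffAt ℝ n (orthoFlat L) 0 := by
  have hb0 : balFill L (0 : Edge 3 L → Fin 3 → ℝ) = 0 := balFill_eq_self L (zero_mem_balancedSet L)
  refine contDiffAt_pi.2 fun e => contDiffAt_pi.2 fun a => ?_
  have hv : ∀ c, ContDiffAt ℝ n (fun y : Edge 3 L → Fin 3 → ℝ => balFill L y e c) 0 := fun c => (contDiff_balFill_apply L e c).contDiffAt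
  have hb : ∀ c, ContDiffAt ℝ n (fun y : Edge 3 L → Fin 3 → ℝ => y (0, e.2) c) 0 := fun c => (contDiff_apply_apply L (0, e.2) c).contDiffAt
  have hs : ContDiffAt ℝ n (fun y : Edge 3 L → Fin 3 → ℝ => 1 - ∑ c, balFill L y e c ^ 2) 0 :=
    contDiffAt_const.sub (ContDiffAt.sum fun c _ => (hv c).pow 2)
  have hs0 : (fun y : Edge 3 L → Fin 3 → ℝ => 1 - ∑ c, balFill L y e c ^ 2) 0 ≠ 0 := by simp [hb0]
  have hsqrt : ContDiffAt ℝ n (fun y : Edge 3 L → Fin 3 → ℝ => Real.sqrt (1 - ∑ c, balFill L y e c ^ 2)) 0 := hs.sqrt hs0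
  have hdot : ContDiffAt ℝ n (fun y : Edge 3 L → Fin 3 → ℝ => balFill L y e ⬝ᵥ y (0, e.2)) 0 := by
    simp only [dotProduct]
    exact ContDiffAt.sum fun c _ => (hv c).mul (hb c)
  have hcross : ContDiffAt ℝ n (fun y : Edge 3 L → Fin 3 → ℝ => (balFill L y e ⨯₃ y (0, e.2)) a) 0 := by
    fin_cases a <;> simp only [cross_apply, Matrix.cons_val_zero, Matrix.cons_val_one, Fin.isValue, Fin.mk_one, Fin.zero_eta]
    · exact ((hv 1).mul (hb 2)).sub ((hv 2).mul (hb 1))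
    · exact ((hv 2).mul (hb 0)).sub ((hv 0).mul (hb 2))
    · exact ((hv 0).mul (hb 1)).sub ((hv 1).mul (hb 0))
  have hnum : ContDiffAt ℝ n (fun y : Edge 3 L → Fin 3 → ℝ =>
      Real.sqrt (1 - ∑ c, balFill L y e c ^ 2) * y (0, e.2) a + balFill L y e a + (balFill L y e ⨯₃ y (0, e.2)) a) 0 :=
    ((hsqrt.mul (hb a)).add (hv a)).add hcross
  have hden : ContDiffAt ℝ n (fun y : Edge 3 L → Fin 3 → ℝ => Real.sqrt (1 - ∑ c, balFill L y e c ^ 2) - balFill L y e ⬝ᵥ y (0, e.2)) 0 := hsqrt.sub hdot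
  have hden0 : (fun y : Edge 3 L → Fin 3 → ℝ => Real.sqrt (1 - ∑ c, balFill L y e c ^ 2) - balFill L y e ⬝ᵥ y (0, e.2)) 0 ≠ 0 := by simp [hb0]
  have h := hnum.div hden hden0
  simp only [orthoFlat]
  exact h

/-- ★★★ **`orthoFlat L` is STRICTLY differentiable at `0` with derivative `orthoFlatLin L`** — the hypothesis of the inverse-function / volume-distortion lemmas
(`HasStrictFDerivAt.approximates_deriv_on_nhds`, `MeasureTheory.addHaar_image_le_mul_of_det_lt`, `MeasureTheory.mul_le_addHaar_image_of_lt_det`). [folklore] -/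
theorem hasStrictFDerivAt_orthoFlat_zero : HasStrictFDerivAt (orthoFlat L) (orthoFlatLin L) 0 := by
  have h := (contDiffAt_orthoFlat_zero L (n := 1)).hasStrictFDerivAt one_ne_zero
  rwa [(hasFDerivAt_orthoFlat_zero L).fderiv] at h

/-- ★★ **Approximate linearity near `0`**: for every `δ > 0` there is `ρ > 0` with `ApproximatesLinearOn (orthoFlat L) (orthoFlatLin L) (ball 0 ρ) δ`. [folklore] -/
theorem approximatesLinearOn_orthoFlat {δ : NNReal} (hδ : 0 < δ) :
    ∃ ρ : ℝ, 0 < ρ ∧ ApproximatesLinearOn (orthoFlat L) (orthoFlatLin L) (Metric.ball 0 ρ) δ := by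
  obtain ⟨s, hs, hA⟩ := (hasStrictFDerivAt_orthoFlat_zero L).approximates_deriv_on_nhds (Or.inr hδ)
  obtain ⟨ρ, hρ, hball⟩ := Metric.mem_nhds_iff.1 hs
  exact ⟨ρ, hρ, hA.mono_set hball⟩

end Summit.QuantumFields.YangMills.Theorems.FemtoTransferGap.TwoLattice.ConstTube

end
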